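/-
Copyright (c) 2026 the pub-hodgecm-mathlib formalisation cell (harness21).  Prover seat hodgecm-mathlib-LD1-p02 (g0), organ payer of half-A
line LD1 on loan to LD2 (organ C₂at′ `ArchSignAt₂'`, dealer LD2-plan (g0) 2026-09-02T03:17:52Z), theta-side kit, 2026-09-02.
THEOREMS ONLY (no definition, no named fact, no `sorry`, no instance, no notation).  `--supports stmt-HodgeConjecture-24832 --as helper`.
-/
import Literature.NumberTheory.Automorphic.Liu2021.ThetaLiftFromLineTorusCovariance
import Summits.HodgeConjecture.HodgeConjecture.Theorems.F0LD2ThetaTensorClasses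
import HarnessLib

/-!
# The Weil torus at one archimedean place, along an ABSTRACT transport `ιA` and in any rank `N`:
# `R(k) [Θ̃_{E(h^V_β ⊗ Φ_f)}(f) ∘ ιA] = (∏_p s_p^{n_p(β)}) • [Θ̃_{E(h^V_β ⊗ Φ_f)}(f) ∘ ιA]` whenever `ιA k = (diag s at w(v₀), 1 elsewhere; 1_f)`

Cell hodgecm-mathlib FLOOR 0, programme P6, half-A line LD (crux `hLiu418` = `stmt-HodgeConjecture-24832`), organ C₂at′ `ArchSignAt₂'` of the LD2
skeleton of record v5 (sha16 e8da573259aec245 :325–:356).  Namespace `Summit.HodgeConjecture.HodgeConjecture.Cruxes.HLiu418.F0LD2ThetaTorusEigenclass`.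

★ `ThetaLiftFromLineTorusCovariance` (node C∞ of the (C♯)hol interior, `N = 3`) proves at the Schwartz–Bruhat level, for ANY rank, that the diagonal
torus `u_s = diag(s)` of `U(σ_{w(v₀)} diag dV)(ℂ)` acts on the Hermite box vectors `E(h^V_β ⊗ Φ_f)` of the line datum by an explicit scalar (§1–§3
there, ★ T2 `pairRep_chiSplittingLine_adelicSingle_tmul_of_box`), and normalises that scalar to `∏_{p : Fin 3} (s p)^{n p}` (§4 there).  This file

* §1 `etaD_mul_vac_mul_prod_of_diagonal` — the EXPONENT NORMAL FORM in any rank `N` (`Fin N × Fin 1 ≃ Fin n′`): the scalar is `∏_{p : Fin N} (s p)^{n p}`,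
  `n p = (τ_w+1)/2 + β(e₁(p,0),v₀)` on the positive sign class `0 < x_{v₀}(e₁(p,0))` and `(τ_w+1)/2 − 1 − β(e₁(p,0),v₀)` on the negative one
  ([KonnoKonno2007, Thm. 5.4, Lem. 5.2]; the ★ proof with `3 ↦ N`);
* §2 **`rightRegular_toLp_lineThetaLift_follandHermite_of_eq_adelicSingle`** — along an ABSTRACT transport `ιA` (★ K1 `F0LD1ThetaTransportKit`): if
  `ιA k = adelicSingle (w(v₀)) u_s`, then `R(k) [Θ̃_{E(h^V_β ⊗ Φ_f)}(f) ∘ ιA] = (∏_p (s p)^{n p}) • [Θ̃_{E(h^V_β ⊗ Φ_f)}(f) ∘ ιA]` in `L²([U(H)], ν)`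
  (★ K1 `rightRegular_toLp_lineThetaLift`; ★ T2; ★ `F0LD2ThetaTensorClasses.toLp_lineThetaLift_smul_left`; §1) — the theta side of organ C₂at′'s integer
  equations, where `k = adelicSingle_H (w(v₀)) (σ(g) u_s σ(g)⁻¹)` by ★ `F0LD2PinnedArchSingleTransport`.

HONEST SCOPE.  Nothing of [Liu2021] is asserted; the archimedean computation is ★ (W1)/(W2)/T2.  HC_CM is proved only modulo the printed citations
until rung 0 closes; this file books nothing and discharges nothing booked.

## References
* [KonnoKonno2007] K. Konno, T. Konno, Thm. 5.4, Lem. 5.2 (K-types of the Weil representation of `U(p,q)`; Fock model).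
* [Folland1989] G. Folland, *Harmonic Analysis in Phase Space*, §1.7, Prop. (4.39).
* [Liu2021] Y. Liu, arXiv:2102.11518, App. D Lem. D.2; proof of Prop. 4.13 Case 1 (l. 2137–2141, p. 48).
* [BorelJacquet1979] A. Borel, H. Jacquet, PSPM 33.1 (1979), §4.1, §4.6.
-/

set_option autoImplicit false
set_option linter.dupNamespace false

noncomputable section

open NumberField NumberField.InfinitePlace MeasureTheory IsDedekindDomain
open scoped Matrix ComplexOrder ENNReal TensorProduct SchwartzMap Kronecker Classical ComplexConjugate

namespace Summit.HodgeConjecture.HodgeConjecture.Cruxes.HLiu418.F0LD2ThetaTorusEigenclass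

open _root_.MeasureTheory
open Literature.NumberTheory.Automorphic Literature.NumberTheory.Automorphic.UnitaryGroup
open Literature.NumberTheory.Automorphic.UnitaryGroup.CotangentForms
open Literature.NumberTheory.Automorphic.IdeleClassGroup
open Literature.NumberTheory.Automorphic.Liu2021
open Literature.NumberTheory.Automorphic.Liu2021.Def411WeilCarriers
open Literature.NumberTheory.Automorphic.Liu2021.Def411WeilCarriersDoubling
open Literature.NumberTheory.Automorphic.Liu2021.CinfThetaTorus
open Literature.NumberTheory.GelbartRogawski1991 Literature.NumberTheory.GelbartRogawski1991.UnitaryDualPair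
open Literature.NumberTheory.GelbartRogawski1991.GRConstruction
open Literature.NumberTheory.Weil1964
open Literature.RepresentationTheory.Liu2021
open Literature.RepresentationTheory.HeisenbergGroup Literature.Analysis.SegalBargmann
open Literature.RepresentationTheory.KonnoKonno2007 Literature.RepresentationTheory.KonnoKonno2007.RealDualPair
open Summit.HodgeConjecture.HodgeConjecture.Cruxes.HLiu418.F0LD1ThetaTransportKit
open Summit.HodgeConjecture.HodgeConjecture.Cruxes.HLiu418.F0LD2ThetaTensorClasses

/-! ## §1 The exponent normal form `∏_p (s p)^{n p}` in any rank `N` -/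

section Line

variable (L : Type) [Field L] [NumberField L] [IsCMField L] {N n' : ℕ} (e₁ : Fin N × Fin 1 ≃ Fin n') (dV : Fin N → L)
  (hdV : ∀ i, IsCMField.complexConj L (dV i) = dV i) (hdV0 : ∀ i, dV i ≠ 0)
  (a : (↥(maximalRealSubfield L))ˣ) (v₀ : {v : InfinitePlace (↥(maximalRealSubfield L)) // v.IsReal})

/-- `k ↦ (e₁⁻¹ k).1` and `p ↦ e₁ (p, 0)` are inverse bijections `Fin n' ≃ Fin N` (`Fin 1` is a point). [folklore] -/
private theorem e₁_symm_fst_apply (p : Fin N) : (e₁.symm (e₁ (p, 0))).1 = p := by rw [Equiv.symm_apply_apply]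

/-- reindexing a product over `Fin n'` along `k = e₁(p, 0)`. [folklore] -/
private theorem prod_fin_eq_prod_fin (f : Fin n' → ℂ) : ∏ k, f k = ∏ p : Fin N, f (e₁ (p, 0)) := by
  rw [Fintype.prod_equiv e₁.symm f (fun pq => f (e₁ pq)) (fun k => by rw [Equiv.apply_symm_apply]), Fintype.prod_prod_type]
  refine Finset.prod_congr rfl fun p _ => ?_
  rw [Fin.prod_univ_one]

include hdV0 in
/-- **THE EXPONENT NORMAL FORM, ANY RANK**: on the line datum (`dW = ⟨a⟩`), for unit `s : Fin N → ℂ`, the scalar `η_τ(k_{v₀,u_s}) · (vac · ∏_k w̄_k^{β(k,v₀)})` equals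
`∏_{p : Fin N} (s p)^{n p}` with `n p = (τ_w+1)/2 + β(e₁(p,0),v₀)` on the positive sign class and `(τ_w+1)/2 − 1 − β(e₁(p,0),v₀)` on the negative one
(★ `coe_etaD_archKPlace_of_diagonal`, ★ `vac_sectionD_archKPlace_of_diagonal`; the ★ `N = 3` text with `3 ↦ N`). [cite: KonnoKonno2007, Thm. 5.4, Lem. 5.2] -/
theorem etaD_mul_vac_mul_prod_of_diagonal (τ : InfinitePlace L → ℤ)
    (u : UnitaryGroup.archLocal L N (Matrix.diagonal dV) (cmPlaceOver L v₀)) (s : Fin N → ℂ) (hs : ∀ p, star (s p) * s p = 1)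
    (hu : (((u : UnitaryGroup.archLocal L N (Matrix.diagonal dV) (cmPlaceOver L v₀)) : GL (Fin N) ℂ) : Matrix (Fin N) (Fin N) ℂ) = Matrix.diagonal s)
    (β : (Fin n' × {v : InfinitePlace (↥(maximalRealSubfield L)) // v.IsReal}) →₀ ℕ) :
    ((etaD L e₁ dV hdV (lineW L (TW (Fp L) a)) (complexConj_lineW L (TW (Fp L) a)) τ
        (archKPlace L e₁ dV hdV (lineW L (TW (Fp L) a)) (complexConj_lineW L (TW (Fp L) a)) v₀ u) : ℂˣ) : ℂ) *
      (MpS.vac (sectionD L e₁ dV hdV hdV0 (lineW L (TW (Fp L) a)) (complexConj_lineW L (TW (Fp L) a))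
          (lineW_ne_zero L (TW (Fp L) a) (isUnit_det_TW (Fp L) a))
          (archKPlace L e₁ dV hdV (lineW L (TW (Fp L) a)) (complexConj_lineW L (TW (Fp L) a)) v₀ u)) *
        ∏ k, star (if 0 < signVec (cmPlaceOver L) (cmGramEntry L e₁ dV hdV (lineW L (TW (Fp L) a)) (complexConj_lineW L (TW (Fp L) a))) (imagUnit L) v₀ k
          then star (s (e₁.symm k).1) else s (e₁.symm k).1) ^ β (k, v₀)) =
      ∏ p : Fin N, s p ^ (if 0 < signVec (cmPlaceOver L) (cmGramEntry L e₁ dV hdV (lineW L (TW (Fp L) a)) (complexConj_lineW L (TW (Fp L) a))) (imagUnit L) v₀ (e₁ (p, 0))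
        then (τ (cmPlaceOver L v₀).1 + 1) / 2 + β (e₁ (p, 0), v₀)
        else (τ (cmPlaceOver L v₀).1 + 1) / 2 - 1 - β (e₁ (p, 0), v₀)) := by
  have hs0 : ∀ p, s p ≠ 0 := fun p h => by have := hs p; rw [h, mul_zero] at this; exact zero_ne_one this
  have hsinv : ∀ p, star (s p) = (s p)⁻¹ := fun p => eq_inv_of_mul_eq_one_left (hs p)
  rw [coe_etaD_archKPlace_of_diagonal L e₁ dV hdV (lineW L (TW (Fp L) a)) (complexConj_lineW L (TW (Fp L) a)) v₀ τ u s hu,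
    vac_sectionD_archKPlace_of_diagonal L e₁ dV hdV hdV0 (lineW L (TW (Fp L) a)) (complexConj_lineW L (TW (Fp L) a))
      (lineW_ne_zero L (TW (Fp L) a) (isUnit_det_TW (Fp L) a)) v₀ u s hu, pow_one]
  -- everything as products over `p : Fin N` of integer powers of `s p`
  set c : ℤ := (τ (cmPlaceOver L v₀).1 + 1) / 2 with hc
  set P : Fin N → Prop := fun p => 0 < signVec (cmPlaceOver L) (cmGramEntry L e₁ dV hdV (lineW L (TW (Fp L) a)) (complexConj_lineW L (TW (Fp L) a)))
    (imagUnit L) v₀ (e₁ (p, 0)) with hP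
  -- (a) the twist character: `(∏ s)^c = ∏_p (s p)^c`
  have ha : (∏ p, s p) ^ c = ∏ p : Fin N, s p ^ c := (Finset.prod_zpow _ _ _).symm
  -- (b) the vacuum: `(∏_{neg k} s)⁻¹ = ∏_p (if P p then 1 else (s p)⁻¹)`
  have hb : (∏ q : NegIdx (signVec (cmPlaceOver L) (cmGramEntry L e₁ dV hdV (lineW L (TW (Fp L) a)) (complexConj_lineW L (TW (Fp L) a))) (imagUnit L) v₀),
      s (e₁.symm q.1).1)⁻¹ = ∏ p : Fin N, (if P p then 1 else s p ^ (-1 : ℤ)) := by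
    rw [← Finset.prod_inv_distrib]
    have h1 : ∏ q : NegIdx (signVec (cmPlaceOver L) (cmGramEntry L e₁ dV hdV (lineW L (TW (Fp L) a)) (complexConj_lineW L (TW (Fp L) a))) (imagUnit L) v₀),
        (s (e₁.symm q.1).1)⁻¹ =
        ∏ k : Fin n', (if 0 < signVec (cmPlaceOver L) (cmGramEntry L e₁ dV hdV (lineW L (TW (Fp L) a)) (complexConj_lineW L (TW (Fp L) a))) (imagUnit L) v₀ k
          then 1 else (s (e₁.symm k).1)⁻¹) := by
      rw [← Finset.prod_subtype (Finset.univ.filter fun k => ¬ 0 < signVec (cmPlaceOver L)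
        (cmGramEntry L e₁ dV hdV (lineW L (TW (Fp L) a)) (complexConj_lineW L (TW (Fp L) a))) (imagUnit L) v₀ k)
        (by intro k; simp) (fun k => (s (e₁.symm k).1)⁻¹), Finset.prod_filter]
      refine Finset.prod_congr rfl fun k _ => ?_
      split_ifs <;> rfl
    rw [h1, prod_fin_eq_prod_fin e₁]
    refine Finset.prod_congr rfl fun p _ => ?_
    rw [e₁_symm_fst_apply, zpow_neg, zpow_one]
  -- (c) the character: `∏_k w̄^β = ∏_p (if P p then s^β else s^{-β})`
  have hc' : ∏ k, star (if 0 < signVec (cmPlaceOver L) (cmGramEntry L e₁ dV hdV (lineW L (TW (Fp L) a)) (complexConj_lineW L (TW (Fp L) a))) (imagUnit L) v₀ k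
        then star (s (e₁.symm k).1) else s (e₁.symm k).1) ^ β (k, v₀) =
      ∏ p : Fin N, (if P p then s p ^ (β (e₁ (p, 0), v₀) : ℤ) else s p ^ (-(β (e₁ (p, 0), v₀) : ℤ))) := by
    rw [prod_fin_eq_prod_fin e₁]
    refine Finset.prod_congr rfl fun p _ => ?_
    rw [e₁_symm_fst_apply]
    by_cases hp : P p
    · rw [if_pos hp, if_pos hp, star_star, zpow_natCast]
    · rw [if_neg hp, if_neg hp, hsinv, zpow_neg, zpow_natCast, inv_pow]
  rw [ha, hb, hc', ← Finset.prod_mul_distrib, ← Finset.prod_mul_distrib]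
  refine Finset.prod_congr rfl fun p _ => ?_
  by_cases hp : P p
  · rw [if_pos hp, if_pos hp, if_pos hp, one_mul, ← zpow_add₀ (hs0 p)]
  · rw [if_neg hp, if_neg hp, if_neg hp, ← zpow_add₀ (hs0 p), ← zpow_add₀ (hs0 p)]
    congr 1
    ring

end Line

/-! ## §2 The torus eigen-identity on the class, along an abstract transport -/

section Covariance

variable (L : Type) [Field L] [NumberField L] [IsCMField L] (N : ℕ) (H : Matrix (Fin N) (Fin N) L)
  {n' : ℕ} (e₁ : Fin N × Fin 1 ≃ Fin n') (dV : Fin N → L) (hdV : ∀ i, IsCMField.complexConj L (dV i) = dV i)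
  (hdV0 : ∀ i, dV i ≠ 0)
  (ιA : (adelicGroupData (↥(maximalRealSubfield L)) L (IsCMField.complexConj L) N H).Adelic →*
    ↥(UnitaryGroup.adelic (↥(maximalRealSubfield L)) L (IsCMField.complexConj L) N (Matrix.diagonal dV)))
  (hιA : Continuous ιA ∧ ∀ ⦃γ : (adelicGroupData (↥(maximalRealSubfield L)) L (IsCMField.complexConj L) N H).Adelic⦄,
    γ ∈ (UnitaryGroup.toAdelic (↥(maximalRealSubfield L)) L (IsCMField.complexConj L) N H).range →
      ιA γ ∈ (UnitaryGroup.toAdelic (↥(maximalRealSubfield L)) L (IsCMField.complexConj L) N (Matrix.diagonal dV)).range)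
  (μ : Literature.NumberTheory.Automorphic.IdeleClassGroup L →ₜ* Circle) (hμ : IsConjugateSymplectic L μ) (a : (↥(maximalRealSubfield L))ˣ)
  (hρ : HasThetaMajorants fun
      (p : ↥(UnitaryGroup.adelic (↥(maximalRealSubfield L)) L (IsCMField.complexConj L) N (Matrix.diagonal dV)) ×
        ↥(UnitaryGroup.adelic (↥(maximalRealSubfield L)) L (IsCMField.complexConj L) 1 (JW (↥(maximalRealSubfield L)) L a)))
      (Φ : piSchwartzBruhat (↥(maximalRealSubfield L)) (Fin n')) =>
        pairRep (↥(maximalRealSubfield L)) L (IsCMField.complexConj L) N 1 e₁ (Matrix.diagonal dV) (JW (↥(maximalRealSubfield L)) L a)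
          (chiSplittingLine L e₁ dV hdV hdV0 (toHeckeCharacter L μ) (isUnitary_toHeckeCharacter L μ)
            ((isOscillatorChar_toHeckeCharacter_iff μ).mpr hμ) (TW (↥(maximalRealSubfield L)) a)
            (isUnit_det_TW (↥(maximalRealSubfield L)) a) (JW (↥(maximalRealSubfield L)) L a) (JW_eq (↥(maximalRealSubfield L)) L a))
          p Φ)
  [CompactSpace (↥(UnitaryGroup.adelic (↥(maximalRealSubfield L)) L (IsCMField.complexConj L) N (Matrix.diagonal dV)) ⧸
    (UnitaryGroup.toAdelic (↥(maximalRealSubfield L)) L (IsCMField.complexConj L) N (Matrix.diagonal dV)).range)]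
  [MeasurableSpace (↥(UnitaryGroup.adelic (↥(maximalRealSubfield L)) L (IsCMField.complexConj L) 1 (JW (↥(maximalRealSubfield L)) L a)) ⧸
    (UnitaryGroup.toAdelic (↥(maximalRealSubfield L)) L (IsCMField.complexConj L) 1 (JW (↥(maximalRealSubfield L)) L a)).range)]
  (μW : Measure (↥(UnitaryGroup.adelic (↥(maximalRealSubfield L)) L (IsCMField.complexConj L) 1 (JW (↥(maximalRealSubfield L)) L a)) ⧸
    (UnitaryGroup.toAdelic (↥(maximalRealSubfield L)) L (IsCMField.complexConj L) 1 (JW (↥(maximalRealSubfield L)) L a)).range))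
  (f : C((↥(UnitaryGroup.adelic (↥(maximalRealSubfield L)) L (IsCMField.complexConj L) 1 (JW (↥(maximalRealSubfield L)) L a)) ⧸
    (UnitaryGroup.toAdelic (↥(maximalRealSubfield L)) L (IsCMField.complexConj L) 1 (JW (↥(maximalRealSubfield L)) L a)).range), ℂ))
  [BorelSpace (↥(UnitaryGroup.adelic (↥(maximalRealSubfield L)) L (IsCMField.complexConj L) 1 (JW (↥(maximalRealSubfield L)) L a)) ⧸
    (UnitaryGroup.toAdelic (↥(maximalRealSubfield L)) L (IsCMField.complexConj L) 1 (JW (↥(maximalRealSubfield L)) L a)).range)]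
  [IsFiniteMeasure μW]
  [CompactSpace (adelicGroupData (↥(maximalRealSubfield L)) L (IsCMField.complexConj L) N H).automorphicQuotient]
  (ν : Measure (adelicGroupData (↥(maximalRealSubfield L)) L (IsCMField.complexConj L) N H).automorphicQuotient) [IsFiniteMeasure ν]
  [SMulInvariantMeasure (adelicGroupData (↥(maximalRealSubfield L)) L (IsCMField.complexConj L) N H).Adelic
    (adelicGroupData (↥(maximalRealSubfield L)) L (IsCMField.complexConj L) N H).automorphicQuotient ν]

include hιA

set_option maxHeartbeats 1600000 in
-- (the line telescope of ★ T2 is large; the rewrites are few)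
/-- **THE TORUS EIGEN-IDENTITY ALONG AN ABSTRACT TRANSPORT, ANY RANK.**  Let `v₀` be a real place of `L⁺`, `w₀ = cmPlaceOver L v₀`, `u_s ∈ U(σ_{w₀} diag dV)(ℂ)`
the diagonal torus element `diag(s)` (`s̄ s = 1`), `τ` a type of the splitting character (`hτ`, `hodd`), `β` a Hermite multi-index, `Φ_f` a finite
Schwartz–Bruhat vector, and `k ∈ U(H)(𝔸)` ANY element with `ιA k = adelicSingle w₀ u_s` (for the pinned transport: `k = adelicSingle_H w₀ (σ(g) u_s σ(g)⁻¹)`, ★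
`F0LD2PinnedArchSingleTransport`).  Then
`R(k) [Θ̃_{E(h^V_β ⊗ Φ_f)}(f) ∘ ιA] = (∏_{p : Fin N} (s p)^{n p}) • [Θ̃_{E(h^V_β ⊗ Φ_f)}(f) ∘ ιA]` in `L²([U(H)], ν)`,
`n p = (τ_{w₀}+1)/2 + β(e₁(p,0),v₀)` on the positive sign class, `(τ_{w₀}+1)/2 − 1 − β(e₁(p,0),v₀)` on the negative one
(★ K1 `rightRegular_toLp_lineThetaLift`; ★ `carrierConjEquiv_frameD_sectionD_archKPlace_of_diagonal` + ★ T2 `pairRep_chiSplittingLine_adelicSingle_tmul_of_box`;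
★ `toLp_lineThetaLift_smul_left`; §1). [cite: KonnoKonno2007, Thm. 5.4, Lem. 5.2] [cite: Folland1989, Prop. (4.39)] [cite: BorelJacquet1979, §4.1, §4.6] -/
theorem rightRegular_toLp_lineThetaLift_follandHermite_of_eq_adelicSingle (v₀ : {v : InfinitePlace (↥(maximalRealSubfield L)) // v.IsReal})
    {τ : InfinitePlace L → ℤ} (hτ : (toHeckeCharacter L μ).HasUnitaryArchType τ 0) (hodd : ∀ w, Odd (τ w))
    (s : Fin N → ℂ) (hs : ∀ p, star (s p) * s p = 1)
    (u : UnitaryGroup.archLocal L N (Matrix.diagonal dV) (cmPlaceOver L v₀))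
    (hu : (((u : UnitaryGroup.archLocal L N (Matrix.diagonal dV) (cmPlaceOver L v₀)) : GL (Fin N) ℂ) : Matrix (Fin N) (Fin N) ℂ) = Matrix.diagonal s)
    (k : (adelicGroupData (↥(maximalRealSubfield L)) L (IsCMField.complexConj L) N H).Adelic)
    (hk : ιA k = UnitaryGroup.adelicSingle (↥(maximalRealSubfield L)) L (IsCMField.complexConj L) N (Matrix.diagonal dV) (IsCMField.complexConj_ne_one L)
      (complexConj_smul_infinitePlace L) (cmPlaceOver L v₀) u)
    (β : (Fin n' × {v : InfinitePlace (↥(maximalRealSubfield L)) // v.IsReal}) →₀ ℕ) (Φf : FinSB (↥(maximalRealSubfield L)) (Fin n')) :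
    (adelicGroupData (↥(maximalRealSubfield L)) L (IsCMField.complexConj L) N H).rightRegular ν k
        (MemLp.toLp _ (memLp_toQuotFun_lineThetaLift L N H e₁ dV hdV hdV0 ιA hιA μ hμ a hρ μW
          (piSchwartzBruhatEquiv (↥(maximalRealSubfield L)) (Fin n')
            (follandHermite (frameV L e₁ dV hdV hdV0 (lineW L (TW (Fp L) a)) (complexConj_lineW L (TW (Fp L) a))
              (lineW_ne_zero L (TW (Fp L) a) (isUnit_det_TW (Fp L) a))) β ⊗ₜ Φf)) f ν 2)) =
      (∏ p : Fin N, s p ^ (if 0 < signVec (cmPlaceOver L) (cmGramEntry L e₁ dV hdV (lineW L (TW (Fp L) a)) (complexConj_lineW L (TW (Fp L) a))) (imagUnit L) v₀ (e₁ (p, 0))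
        then (τ (cmPlaceOver L v₀).1 + 1) / 2 + β (e₁ (p, 0), v₀)
        else (τ (cmPlaceOver L v₀).1 + 1) / 2 - 1 - β (e₁ (p, 0), v₀))) •
        MemLp.toLp _ (memLp_toQuotFun_lineThetaLift L N H e₁ dV hdV hdV0 ιA hιA μ hμ a hρ μW
          (piSchwartzBruhatEquiv (↥(maximalRealSubfield L)) (Fin n')
            (follandHermite (frameV L e₁ dV hdV hdV0 (lineW L (TW (Fp L) a)) (complexConj_lineW L (TW (Fp L) a))
              (lineW_ne_zero L (TW (Fp L) a) (isUnit_det_TW (Fp L) a))) β ⊗ₜ Φf)) f ν 2) := by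
  set eV := frameV L e₁ dV hdV hdV0 (lineW L (TW (Fp L) a)) (complexConj_lineW L (TW (Fp L) a))
    (lineW_ne_zero L (TW (Fp L) a) (isUnit_det_TW (Fp L) a)) with heV
  -- the Weil side: `ω((u at w₀), 1) E(h^V_β ⊗ Φ_f) = scalar • E(h^V_β ⊗ Φ_f)`
  have hbox := carrierConjEquiv_frameD_sectionD_archKPlace_of_diagonal L e₁ dV hdV hdV0 (lineW L (TW (Fp L) a)) (complexConj_lineW L (TW (Fp L) a))
    (lineW_ne_zero L (TW (Fp L) a) (isUnit_det_TW (Fp L) a)) v₀ u s hu β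
  -- the equivariance of the class along `ιA`
  have hE := rightRegular_toLp_lineThetaLift L N H e₁ dV hdV hdV0 ιA hιA μ hμ a hρ μW
    (piSchwartzBruhatEquiv (Fp L) (Fin n') (follandHermite eV β ⊗ₜ Φf)) f ν k
  rw [hk] at hE
  by_cases hΦf : Φf = 0
  · -- trivial case `Φ_f = 0`: both sides are `0`
    subst hΦf
    rw [TensorProduct.tmul_zero, map_zero, ← zero_smul ℂ (0 : piSchwartzBruhat (Fp L) (Fin n')),
      toLp_lineThetaLift_smul_left L N H e₁ dV hdV hdV0 ιA hιA μ hμ a hρ μW f ν, zero_smul, map_zero, smul_zero]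
  have hne : piSchwartzBruhatEquiv (Fp L) (Fin n') (follandHermite eV 0 ⊗ₜ Φf) ≠ 0 :=
    piSchwartzBruhatEquiv_tmul_ne_zero (gaussianV_ne_zero L e₁ dV hdV hdV0 _ _ _) hΦf
  have hT2 := pairRep_chiSplittingLine_adelicSingle_tmul_of_box L dV hdV hdV0 v₀ e₁ (isUnitary_toHeckeCharacter L μ)
    ((isOscillatorChar_toHeckeCharacter_iff μ).mpr hμ) hτ hodd (TW (Fp L) a) (isUnit_det_TW (Fp L) a) (JW (Fp L) L a) (JW_eq (Fp L) L a) u hbox Φf hne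
  rw [toLp_lineThetaLift_congr L N H e₁ dV hdV hdV0 ιA hιA μ hμ a hρ μW f ν hT2,
    toLp_lineThetaLift_smul_left L N H e₁ dV hdV hdV0 ιA hιA μ hμ a hρ μW f ν,
    etaD_mul_vac_mul_prod_of_diagonal L e₁ dV hdV hdV0 a v₀ τ u s hs hu β] at hE
  exact hE

end Covariance

end Summit.HodgeConjecture.HodgeConjecture.Cruxes.HLiu418.F0LD2ThetaTorusEigenclass

end
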